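import Summits.ResolutionOfSingularities.ResolutionOfSingularities.Theorems.EquisingularLiftEquisingularLiftNatSpecimenQuarticPointStep
import Mathlib.RingTheory.MvPolynomial.Homogeneous
import HarnessLib

/-!
# [OURS · L1 W4.5(b)] EL♮ specimens — CONES OVER PLANE CURVES, generic vertex chart: the blow-up of the cone `V(G) ⊂ 𝔸³` at its vertex
# has chart rings `k[T₀,T₁,T₂]/(G(T)|_{Tᵢ := 1})` (crux `Theses.EquisingularLift.EquisingularLiftNat`, stmt-ResolutionOfSingularities-20038)

NOT a statement of any manuscript; OURS generic lemma (cell `res-hironaka`, chain w45b; seat res-D-pv-013, own initiative, counted 0), the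
`G`-generic form of `…SpecimenFermatConeAlgebra.isRegularRing_vertexChart_of` (p515964). AI-written, weaker than expert review.

Let `G ∈ A = k[y₀, y₁, y₂]` be a NON-ZERO HOMOGENEOUS polynomial of degree `d` (the equation of the affine cone over the plane curve `V₊(G)`),
`𝔪 = (y₀, y₁, y₂)` the vertex, and `A[𝔪/yᵢ]` the `i`-th chart of the blow-up of `𝔸³` at the origin (tree `PointBlowup.Chart 2 k i`; here
`exists_algEquiv_pointChart : k[T₀,T₁,T₂] ≃ₐ[k] A[𝔪/yᵢ]`, `Tᵢ ↦ yᵢ`, `T_j ↦ y_j/yᵢ`, the `k`-ALGEBRA form of res-L1-w45b-stub-4's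
`exists_ringEquiv_pointChart`). With `gᵢ := G(T)|_{Tᵢ := 1} = MvPolynomial.aeval (Function.update X i 1) G` (a polynomial in the `T_j`,
`j ≠ i`, times nothing — `Tᵢ` does not occur):

* `aeval_smul_eq_pow_mul_aeval` — homogeneity: `G(c • v) = c^d · G(v)`;
* `algebraMap_eq_exc_pow_mul` — in `A[𝔪/yᵢ]`: `G = yᵢ^d · G(y/yᵢ)` (exceptional factor times strict transform);
* `aeval_update_one_ne_zero` (`gᵢ ≠ 0`: dehomogenising a non-zero form), `not_X_dvd_aeval_update_one` (`Tᵢ ∤ gᵢ`);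
* **`isRegularRing_vertexChart_of_isHomogeneous`** — `(A/(G))[𝔪̄/ȳᵢ] ≅ A[𝔪/yᵢ]/(θ gᵢ) ≅ k[T]/(gᵢ)` (GW Prop. 13.96 (2),
  `blowupAlgebra.quotientKerMapQuotientEquiv`, `prime_exc`), hence the `i`-th chart of `Bl_vertex V(G)` is a regular ring as soon as
  `k[T₀,T₁,T₂]/(gᵢ)` is — i.e. as soon as the affine chart `Tᵢ = 1` of the PLANE CURVE `V₊(G)` is regular (times the free exceptional
  coordinate `Tᵢ`).

References: Görtz–Wedhorn I Prop. 13.96 (2); The Stacks Project 0BIQ, 0804; Hartshorne II Ex. 7.12 — through the cited tree files.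
-/

set_option linter.dupNamespace false -- mandated namespace `Summit.<Summit>.<Problem>` of this single-conjunct summit

noncomputable section

open MvPolynomial
open Literature.AlgebraicGeometry.Resolution
open Summit.ResolutionOfSingularities.ResolutionOfSingularities.Theorems.EquisingularLift.SpecimenQuartic

namespace Summit.ResolutionOfSingularities.ResolutionOfSingularities.Cruxes.EquisingularLiftNat.Sections

namespace Cone

variable (k : Type) [Field k]

/-! ## Homogeneity: `G(c • v) = c^d · G(v)` -/

variable {k} in
/-- A homogeneous polynomial of degree `d` is homogeneous of weight `d` in its arguments: `G(c·v₀, c·v₁, …) = c^d · G(v)` for every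
commutative `k`-algebra `S`, `c ∈ S`, `v ∈ S^σ`. [folklore] -/
theorem aeval_smul_eq_pow_mul_aeval {σ : Type*} {S : Type*} [CommRing S] [Algebra k S] {G : MvPolynomial σ k} {d : ℕ}
    (hG : G.IsHomogeneous d) (c : S) (v : σ → S) :
    aeval (fun j => c * v j) G = c ^ d * aeval v G := by
  classical
  conv_lhs => rw [G.as_sum]
  conv_rhs => rw [G.as_sum]
  rw [map_sum, map_sum, Finset.mul_sum]
  refine Finset.sum_congr rfl fun m hm => ?_
  have hdeg : (∑ j ∈ m.support, m j) = d := by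
    have h := hG (mem_support_iff.mp hm)
    rw [Finsupp.weight_apply, Finsupp.sum] at h
    simpa using h
  rw [aeval_monomial, aeval_monomial, Finsupp.prod, Finsupp.prod]
  simp only [mul_pow, Finset.prod_mul_distrib]
  rw [Finset.prod_pow_eq_pow_sum, hdeg]
  ring

/-! ## The `k`-algebra chart isomorphism `k[T₀, T₁, T₂] ≅ A[𝔪/yᵢ]` -/

/-- **`k[T₀, T₁, T₂] ≃ₐ[k] A[𝔪/yᵢ]`, `Tᵢ ↦ yᵢ`, `T_j ↦ y_j/yᵢ` (`j ≠ i`)** — the tree's `PointBlowup.polyEquiv` reindexed through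
`Fin 3 ≃ Unit ⊕ {j // j ≠ i}` (as in res-L1-w45b-stub-4's `exists_ringEquiv_pointChart`), upgraded to a `k`-algebra isomorphism. [folklore] -/
theorem exists_algEquiv_pointChart (i : Fin 3) :
    ∃ θ : MvPolynomial (Fin 3) k ≃ₐ[k] PointBlowup.Chart 2 k i,
      θ (X i) = PointBlowup.exc 2 k i ∧ ∀ (j : Fin 3) (hj : j ≠ i), θ (X j) = PointBlowup.frac 2 k i j := by
  let e : Fin 3 ≃ Unit ⊕ {j : Fin 3 // j ≠ i} :=
    ((Equiv.optionSubtypeNe i).symm.trans (Equiv.optionEquivSumPUnit {j : Fin 3 // j ≠ i})).trans (Equiv.sumComm _ _)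
  have hei : e i = Sum.inl () := by simp [e]
  have hej : ∀ (j : Fin 3) (hj : j ≠ i), e j = Sum.inr ⟨j, hj⟩ := by
    intro j hj
    simp [e, Equiv.optionSubtypeNe_symm_of_ne hj]
  have hC : ∀ c : k, PointBlowup.polyEquiv 2 k i (algebraMap k (MvPolynomial Unit (PointBlowup.Base 2 k i)) c) =
      algebraMap k (PointBlowup.Chart 2 k i) c := by
    intro c
    rw [IsScalarTower.algebraMap_apply k (PointBlowup.Base 2 k i) (MvPolynomial Unit (PointBlowup.Base 2 k i)),
      MvPolynomial.algebraMap_eq, MvPolynomial.algebraMap_eq, PointBlowup.polyEquiv_apply, PointBlowup.polyHom_C,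
      PointBlowup.baseHom_C]
  let ρ : MvPolynomial Unit (PointBlowup.Base 2 k i) ≃ₐ[k] PointBlowup.Chart 2 k i :=
    AlgEquiv.ofRingEquiv (f := PointBlowup.polyEquiv 2 k i) hC
  refine ⟨((renameEquiv k e).trans (sumAlgEquiv k Unit {j : Fin 3 // j ≠ i})).trans ρ, ?_, ?_⟩
  · simp [ρ, hei]
  · intro j hj
    simp [ρ, hej j hj]

/-! ## The strict transform of the cone on the chart `A[𝔪/yᵢ]` -/

section Chart

variable (G : MvPolynomial (Fin 3) k) (i : Fin 3)

/-- The chart map `k[y] → A[𝔪/yᵢ]` is evaluation at `(yᵢ · (y_j/yᵢ))_j` (with `yᵢ/yᵢ = 1`). [folklore] -/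
theorem algebraMap_eq_aeval_exc_mul_frac :
    algebraMap (MvPolynomial (Fin 3) k) (PointBlowup.Chart 2 k i) G =
      aeval (fun j => PointBlowup.exc 2 k i * PointBlowup.frac 2 k i j) G := by
  have h := congrArg (fun φ : MvPolynomial (Fin 3) k →ₐ[k] PointBlowup.Chart 2 k i => φ G)
    (MvPolynomial.algHom_ext (A := PointBlowup.Chart 2 k i)
      (f := IsScalarTower.toAlgHom k (MvPolynomial (Fin 3) k) (PointBlowup.Chart 2 k i))
      (g := aeval fun j => PointBlowup.exc 2 k i * PointBlowup.frac 2 k i j) fun j => by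
        rw [IsScalarTower.toAlgHom_apply, aeval_X]
        exact PointBlowup.algebraMap_X 2 k i j)
  simpa using h

variable {d : ℕ} (hG : G.IsHomogeneous d)

include hG in
/-- **`G = yᵢ^d · G(y/yᵢ)` in `A[𝔪/yᵢ]`** for `G` homogeneous of degree `d`. [folklore] -/
theorem algebraMap_eq_exc_pow_mul :
    algebraMap (MvPolynomial (Fin 3) k) (PointBlowup.Chart 2 k i) G =
      PointBlowup.exc 2 k i ^ d * aeval (PointBlowup.frac 2 k i) G := by
  rw [algebraMap_eq_aeval_exc_mul_frac, aeval_smul_eq_pow_mul_aeval hG]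

/-- Dehomogenising at `Tᵢ` and then setting `Tᵢ := 0` changes nothing (the result does not involve `Tᵢ`). [folklore] -/
theorem aeval_update_zero_aeval_update_one :
    aeval (Function.update (X : Fin 3 → MvPolynomial (Fin 3) k) i 0)
        (aeval (Function.update (X : Fin 3 → MvPolynomial (Fin 3) k) i 1) G) =
      aeval (Function.update (X : Fin 3 → MvPolynomial (Fin 3) k) i 1) G := by
  rw [← AlgHom.comp_apply, comp_aeval]
  have hv : (fun j => aeval (Function.update (X : Fin 3 → MvPolynomial (Fin 3) k) i 0)
      (Function.update (X : Fin 3 → MvPolynomial (Fin 3) k) i 1 j)) =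
      Function.update (X : Fin 3 → MvPolynomial (Fin 3) k) i 1 := by
    funext j
    by_cases hj : j = i
    · subst hj
      simp
    · simp [Function.update_of_ne hj]
  rw [hv]

/-- Under the chart isomorphism `θ`, the dehomogenised form `gᵢ = G(T)|_{Tᵢ := 1}` goes to `G(y/yᵢ)`. [folklore] -/
theorem algEquiv_aeval_update_one (θ : MvPolynomial (Fin 3) k ≃ₐ[k] PointBlowup.Chart 2 k i)
    (hθj : ∀ (j : Fin 3) (hj : j ≠ i), θ (X j) = PointBlowup.frac 2 k i j) :
    θ (aeval (Function.update (X : Fin 3 → MvPolynomial (Fin 3) k) i 1) G) = aeval (PointBlowup.frac 2 k i) G := by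
  have h := MvPolynomial.algHom_ext (A := PointBlowup.Chart 2 k i)
    (f := (θ : MvPolynomial (Fin 3) k →ₐ[k] PointBlowup.Chart 2 k i).comp
      (aeval (Function.update (X : Fin 3 → MvPolynomial (Fin 3) k) i 1)))
    (g := aeval (PointBlowup.frac 2 k i)) fun j => by
      rw [AlgHom.comp_apply, aeval_X, aeval_X]
      by_cases hj : j = i
      · subst hj
        rw [Function.update_self, map_one, PointBlowup.frac_self]
      · rw [Function.update_of_ne hj]
        exact hθj j hj
  exact DFunLike.congr_fun h G

include hG in
/-- **Dehomogenising a NON-ZERO form gives a non-zero polynomial**: `gᵢ ≠ 0` for `G ≠ 0` homogeneous (`k[y] → A[𝔪/yᵢ]` is injective and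
there `G = yᵢ^d · θ(gᵢ)`). [folklore] -/
theorem aeval_update_one_ne_zero (hG0 : G ≠ 0) :
    aeval (Function.update (X : Fin 3 → MvPolynomial (Fin 3) k) i 1) G ≠ 0 := by
  obtain ⟨θ, -, hθj⟩ := exists_algEquiv_pointChart k i
  intro h0
  have h1 : aeval (PointBlowup.frac 2 k i) G = 0 := by
    rw [← algEquiv_aeval_update_one k G i θ hθj, h0, map_zero]
  have h2 : algebraMap (MvPolynomial (Fin 3) k) (PointBlowup.Chart 2 k i) G = 0 := by
    rw [algebraMap_eq_exc_pow_mul k G i hG, h1, mul_zero]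
  -- `k[y] → A[𝔪/yᵢ] ⊆ k[y][1/yᵢ]` is injective
  have h3 : algebraMap (MvPolynomial (Fin 3) k) (Localization.Away (X i : MvPolynomial (Fin 3) k)) G = 0 := by
    have h := congrArg (Subalgebra.val (blowupAlgebra (PointBlowup.originIdeal 2 k) (X i : MvPolynomial (Fin 3) k))) h2
    rw [map_zero] at h
    exact h
  exact hG0 ((IsLocalization.injective (Localization.Away (X i : MvPolynomial (Fin 3) k))
    (powers_le_nonZeroDivisors_of_noZeroDivisors (X_ne_zero i))) (by rw [h3, map_zero]))

include hG in
/-- `Tᵢ ∤ gᵢ` (for `G ≠ 0`): `gᵢ` does not involve `Tᵢ`, and is non-zero. [folklore] -/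
theorem not_X_dvd_aeval_update_one (hG0 : G ≠ 0) :
    ¬ (X i : MvPolynomial (Fin 3) k) ∣ aeval (Function.update (X : Fin 3 → MvPolynomial (Fin 3) k) i 1) G := by
  rintro ⟨h, hh⟩
  apply aeval_update_one_ne_zero k G i hG hG0
  rw [← aeval_update_zero_aeval_update_one k G i, hh, map_mul, aeval_X, Function.update_self, zero_mul]

include hG in
/-- **GENERIC VERTEX CHART OF A CONE.** For `G ∈ k[y₀,y₁,y₂]` non-zero homogeneous of degree `d` and `gᵢ = G(T)|_{Tᵢ := 1}`: if
`k[T₀,T₁,T₂]/(gᵢ)` is a regular ring then so is the `i`-th chart `(A/(G))[𝔪̄/ȳᵢ]` of the blow-up of the cone `V(G)` at its vertex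
(`≅ A[𝔪/yᵢ]/(θ gᵢ)`, GW 13.96 (2)). [folklore; GW 13.96 (2)] -/
theorem isRegularRing_vertexChart_of_isHomogeneous (hG0 : G ≠ 0)
    (hreg : IsRegularRing (MvPolynomial (Fin 3) k ⧸
      Ideal.span {aeval (Function.update (X : Fin 3 → MvPolynomial (Fin 3) k) i 1) G})) :
    IsRegularRing (blowupAlgebra ((PointBlowup.originIdeal 2 k).map (Ideal.Quotient.mk (Ideal.span {G})))
      (Ideal.Quotient.mk (Ideal.span {G}) (X i))) := by
  obtain ⟨θ, hθi, hθj⟩ := exists_algEquiv_pointChart k i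
  have hθg := algEquiv_aeval_update_one k G i θ hθj
  -- `G = yᵢ^d · θ(gᵢ)` in `A[𝔪/yᵢ]`
  have hf : algebraMap (MvPolynomial (Fin 3) k) (PointBlowup.Chart 2 k i) G =
      algebraMap (MvPolynomial (Fin 3) k) (PointBlowup.Chart 2 k i) (X i) ^ d *
        θ (aeval (Function.update (X : Fin 3 → MvPolynomial (Fin 3) k) i 1) G) := by
    rw [hθg]
    exact algebraMap_eq_exc_pow_mul k G i hG
  -- `yᵢ ∤ θ(gᵢ)`
  have hndvd : ¬ algebraMap (MvPolynomial (Fin 3) k) (PointBlowup.Chart 2 k i) (X i) ∣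
      θ (aeval (Function.update (X : Fin 3 → MvPolynomial (Fin 3) k) i 1) G) := by
    intro h
    apply not_X_dvd_aeval_update_one k G i hG hG0
    have h' : θ (X i) ∣ θ (aeval (Function.update (X : Fin 3 → MvPolynomial (Fin 3) k) i 1) G) := by rwa [hθi]
    exact (map_dvd_iff (θ : MvPolynomial (Fin 3) k ≃* PointBlowup.Chart 2 k i)).mp h'
  -- `k[T]/(gᵢ) ≅ A[𝔪/yᵢ]/(θ gᵢ)`
  have hmap : Ideal.map θ (Ideal.span {aeval (Function.update (X : Fin 3 → MvPolynomial (Fin 3) k) i 1) G}) =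
      Ideal.span {θ (aeval (Function.update (X : Fin 3 → MvPolynomial (Fin 3) k) i 1) G)} := by
    rw [Ideal.map_span, Set.image_singleton]
  haveI := hreg
  haveI : IsRegularRing (PointBlowup.Chart 2 k i ⧸
      Ideal.span {θ (aeval (Function.update (X : Fin 3 → MvPolynomial (Fin 3) k) i 1) G)}) :=
    IsRegularRing.of_ringEquiv (Ideal.quotientEquiv _ _ θ.toRingEquiv (by
      rw [← hmap]; rfl))
  exact IsRegularRing.of_ringEquiv
    (R := PointBlowup.Chart 2 k i ⧸ Ideal.span {θ (aeval (Function.update (X : Fin 3 → MvPolynomial (Fin 3) k) i 1) G)})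
    (blowupAlgebra.quotientKerMapQuotientEquiv _ _ hf (prime_exc k i) hndvd)

end Chart

end Cone

end Summit.ResolutionOfSingularities.ResolutionOfSingularities.Cruxes.EquisingularLiftNat.Sections

end
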